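import Mathlib

/-!
# A point of the unit sphere of `ℍ ≅ ℝ⁴` far from a finite set (volume count)
# (toolkit for the stub `stub_innerWindowGaugeSmall` of `BackwardLiouvilleRigidity.FlatRatioTermination`, stmt-QuantumFields-22542)

`exists_far_unit_quaternion`: if `s` is a finite set of quaternions and `0 < ρ ≤ 1/2` with `2·|s|·ρ³ < 1`, there is a unit
quaternion `q` with `‖q − c‖ ≥ ρ` for every `c ∈ s`.  Proof: otherwise the spherical shell `1 − ρ < ‖v‖ < 1 + ρ` (Lebesgue
measure `((1+ρ)⁴ − (1−ρ)⁴)·|B⁴| ≥ 8ρ·|B⁴|`) would be covered by the balls `B(c, 2ρ)` (total measure `≤ 16|s|ρ⁴·|B⁴|`).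
The Borel structure on `ℍ` is introduced inside the proof (`borelize`), the measure is the Haar measure of the standard
orthonormal basis; no instance is declared.

HONEST SCOPE.  Elementary measure count, `--supports stmt-QuantumFields-22542`; nothing about gauge fields, the crux, rung R3 or
any summit statement; nothing here bears on the Yang–Mills mass gap.
-/

namespace Summit.QuantumFields.YangMills.Theorems.FlatRatioTermination.Cone

open MeasureTheory Metric
open scoped Quaternion

/-- Normalising a vector of the shell `1 − ρ < ‖v‖ < 1 + ρ` moves it by less than `ρ`. [folklore] -/
theorem norm_sub_normalize_lt {v : ℍ} {ρ : ℝ} (h1 : 1 - ρ < ‖v‖) (h2 : ‖v‖ < 1 + ρ) (hv : v ≠ 0) :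
    ‖v - ‖v‖⁻¹ • v‖ < ρ := by
  have hn : 0 < ‖v‖ := norm_pos_iff.mpr hv
  have e : v - ‖v‖⁻¹ • v = (1 - ‖v‖⁻¹) • v := by rw [sub_smul, one_smul]
  rw [e, norm_smul, Real.norm_eq_abs]
  have e2 : |1 - ‖v‖⁻¹| * ‖v‖ = |‖v‖ - 1| := by
    rw [show (1 : ℝ) - ‖v‖⁻¹ = (‖v‖ - 1) / ‖v‖ by field_simp, abs_div, abs_of_pos hn]
    field_simp
  rw [e2, abs_lt]
  constructor <;> linarith

/-- **A UNIT QUATERNION FAR FROM A FINITE SET.**  If `0 < ρ ≤ 1/2` and `2·|s|·ρ³ < 1` then some unit quaternion is at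
distance `≥ ρ` from every element of `s` (volume count in the shell `1 − ρ < ‖v‖ < 1 + ρ`). [folklore] -/
theorem exists_far_unit_quaternion (s : Finset ℍ) {ρ : ℝ} (hρ : 0 < ρ) (hρ1 : ρ ≤ 1 / 2)
    (hcard : 2 * (s.card : ℝ) * ρ ^ 3 < 1) : ∃ q : ℍ, ‖q‖ = 1 ∧ ∀ c ∈ s, ρ ≤ ‖q - c‖ := by
  by_contra H
  push Not at H
  -- the shell is covered by the balls `B(c, 2ρ)`
  set S : Set ℍ := ball (0 : ℍ) (1 + ρ) \ closedBall (0 : ℍ) (1 - ρ) with hS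
  have hcover : S ⊆ ⋃ c ∈ s, ball c (2 * ρ) := by
    intro v hv
    rw [hS, Set.mem_sdiff, mem_ball_zero_iff, mem_closedBall_zero_iff, not_le] at hv
    have hv0 : v ≠ 0 := by
      intro h; rw [h, norm_zero] at hv; linarith [hv.2]
    have hq1 : ‖(‖v‖⁻¹ • v : ℍ)‖ = 1 := by
      rw [norm_smul, norm_inv, norm_norm, inv_mul_cancel₀ (norm_ne_zero_iff.mpr hv0)]
    obtain ⟨c, hc, hqc⟩ := H _ hq1
    have hvq := norm_sub_normalize_lt hv.2 hv.1 hv0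
    refine Set.mem_biUnion hc ?_
    rw [mem_ball, dist_eq_norm]
    calc ‖v - c‖ ≤ ‖v - ‖v‖⁻¹ • v‖ + ‖‖v‖⁻¹ • v - c‖ := norm_sub_le_norm_sub_add_norm_sub _ _ _
      _ < ρ + ρ := add_lt_add hvq hqc
      _ = 2 * ρ := by ring
  -- volumes (Haar measure of the standard orthonormal basis; Borel structure introduced locally)
  borelize ℍ
  set μ : Measure ℍ := (stdOrthonormalBasis ℝ ℍ).toBasis.addHaar with hμ
  set V : ENNReal := μ (ball (0 : ℍ) 1) with hV
  have hV0 : V ≠ 0 := (measure_ball_pos μ (0 : ℍ) one_pos).ne'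
  have hVtop : V ≠ ⊤ := measure_ball_lt_top.ne
  have hfin : Module.finrank ℝ ℍ = 4 := Quaternion.finrank_eq_four
  have h1ρ : 0 ≤ 1 - ρ := by linarith
  have hball : μ (ball (0 : ℍ) (1 + ρ)) = ENNReal.ofReal ((1 + ρ) ^ 4) * V := by
    rw [Measure.addHaar_ball_of_pos μ (0 : ℍ) (by linarith : 0 < 1 + ρ), hfin]
  have hclosed : μ (closedBall (0 : ℍ) (1 - ρ)) = ENNReal.ofReal ((1 - ρ) ^ 4) * V := by
    rw [Measure.addHaar_closedBall μ (0 : ℍ) h1ρ, hfin]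
  have hsmall : ∀ c ∈ s, μ (ball c (2 * ρ)) = ENNReal.ofReal ((2 * ρ) ^ 4) * V := by
    intro c _
    rw [Measure.addHaar_ball_of_pos μ c (by linarith : 0 < 2 * ρ), hfin]
  -- `μ(ball (1+ρ)) ≤ μ(S) + μ(closedBall (1−ρ)) ≤ Σ μ(ball c 2ρ) + μ(closedBall (1−ρ))`
  have hsub : ball (0 : ℍ) (1 + ρ) ⊆ S ∪ closedBall (0 : ℍ) (1 - ρ) := by
    intro v hv
    by_cases h : v ∈ closedBall (0 : ℍ) (1 - ρ)
    · exact Or.inr h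
    · exact Or.inl ⟨hv, h⟩
  have hle : ENNReal.ofReal ((1 + ρ) ^ 4) * V
      ≤ ENNReal.ofReal (s.card * (2 * ρ) ^ 4 + (1 - ρ) ^ 4) * V := by
    calc ENNReal.ofReal ((1 + ρ) ^ 4) * V = μ (ball (0 : ℍ) (1 + ρ)) := hball.symm
      _ ≤ μ (S ∪ closedBall (0 : ℍ) (1 - ρ)) := measure_mono hsub
      _ ≤ μ S + μ (closedBall (0 : ℍ) (1 - ρ)) := measure_union_le _ _
      _ ≤ μ (⋃ c ∈ s, ball c (2 * ρ)) + μ (closedBall (0 : ℍ) (1 - ρ)) := by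
          gcongr
      _ ≤ (∑ c ∈ s, μ (ball c (2 * ρ))) + μ (closedBall (0 : ℍ) (1 - ρ)) := by
          gcongr; exact measure_biUnion_finset_le _ _
      _ = (∑ c ∈ s, ENNReal.ofReal ((2 * ρ) ^ 4) * V) + ENNReal.ofReal ((1 - ρ) ^ 4) * V := by
          rw [hclosed, Finset.sum_congr rfl hsmall]
      _ = ENNReal.ofReal (s.card * (2 * ρ) ^ 4 + (1 - ρ) ^ 4) * V := by
          rw [Finset.sum_const, nsmul_eq_mul, ← mul_assoc, ← add_mul]
          congr 1
          rw [ENNReal.ofReal_add (by positivity) (by positivity), ENNReal.ofReal_mul (by positivity),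
            ENNReal.ofReal_natCast]
  have hle' : ENNReal.ofReal ((1 + ρ) ^ 4) ≤ ENNReal.ofReal (s.card * (2 * ρ) ^ 4 + (1 - ρ) ^ 4) :=
    (ENNReal.mul_le_mul_iff_left hV0 hVtop).mp hle
  rw [ENNReal.ofReal_le_ofReal_iff (by positivity)] at hle'
  -- contradiction with `2|s|ρ³ < 1`
  have hs0 : (0 : ℝ) ≤ s.card := by positivity
  nlinarith [mul_nonneg hs0 (pow_nonneg hρ.le 4), pow_pos hρ 3, pow_pos hρ 4]

end Summit.QuantumFields.YangMills.Theorems.FlatRatioTermination.Cone
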